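import Summits.CriticalPhenomena.PercolationContinuityZ3.Theorems.PercNearOneGluingNoHeavyLowerTailKernelCornersTwo
import Summits.CriticalPhenomena.PercolationContinuityZ3.Theorems.PercNearOneGluingAdditiveGluingML5Base
import Mathlib.Algebra.BigOperators.Group.Finset.Powerset
import HarnessLib

/-!
# `NoHeavyLowerTail` (stmt-CriticalPhenomena-4575) — THE `2+2` KERNEL: Kozma–Nitzan's Question 9 for a one-layer observer
# with four ports whose witness is admissible in the split graph of two 2-port stars

Support file (lemma factory `prim-lf-3` gen 7, seat g9; `--supports stmt-CriticalPhenomena-4575`).  No definitions, no named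
facts, no sorries.  Memo: `run/shared/lean/prim/prim-lf-3/LF3-BETA-R.md` (theorem §0, proof §2–4, assembly §8–9); lead memo
`prim-nh-lead-4575/KERNEL-BETA-R-TORUS.md`.

`o` is a one-layer observer with ports `p₁,p₂,q₁,q₂` (hairs `h₁,h₂,k₁,k₂ ∈ (0,1)`, every other pair at `o` of weight `0`), `K = W` with `o`
killed (the core), `u = h₁h₂`, `v = k₁k₂`, `KP = K[s(p₁,p₂) ↦ 1]`, `KQ = K[s(q₁,q₂) ↦ 1]`, `KPQ` both.  HYPOTHESIS (the SPLIT ROWS): for each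
port `z`, `0 ≤ (1−u)(1−v)(z−j)_K + u(1−v)(z−j)_{KP} + (1−u)v(z−j)_{KQ} + uv(z−j)_{KPQ}` — by the series/gluing rule this says that the witness
`j` is at most as reliable (towards `b`) as `z` in the graph where `o` is replaced by two SEPARATE 2-port stars `x` (hairs `h₁,h₂` to `p₁,p₂`)
and `y` (hairs `k₁,k₂` to `q₁,q₂`), i.e. `j` is an admissible witness for Kozma–Nitzan's Question 9 at the depth-two observer `x – o – y`
with sure inner bonds.  CONCLUSION (KN's inequality (41) at the glued observer): `μ_W(j ↔ b, o ↔ A) ≤ μ_W(o ↔ b)`.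

Proof.  `oneLayer_margin_eq_sum_forced` writes the margin as `F = Σ_{∅ ≠ B ⊆ ports} π(B) · G(B)` with `π(B)` the star-pattern law
(`real_starEvent_eq_prod_ports`) and `G(B)` the forced-star margin.  `F` is affine in `(h₁, h₂)` along the hyperbola `h₁h₂ = u`, so
`hyperbola_affine_ge_min3` bounds it below by the minimum of the formal corner `c`, and the two sure-hair corners `c + dᵢ(1−u)`; the latter
are `arcCorner`.  The formal corner `c` is treated the same way in `(k₁, k₂)`: its three corners are `ffCorner` and `mixedCorner` (twice).
-/

namespace Summit.CriticalPhenomena.PercolationContinuityZ3.Theorems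

open MeasureTheory Set ProbabilityTheory
open Literature.Probability.LatticeModels
open Literature.Probability.Percolation

noncomputable section
open Classical

namespace UpsetExchange

variable {n : ℕ}

/-- Probability of a star pattern of a one-layer observer with port set `P`: `∏_{p ∈ B} h_p · ∏_{u ∈ P ∖ B} (1 − h_u)`.
[cite: KozmaNitzan2024, proof of Thm. 4 (pp. 13–14)] -/
theorem real_starEvent_eq_prod_ports (W : Sym2 (Fin n) → unitInterval) (o : Fin n) (P B : Finset (Fin n))
    (hoP : o ∉ P) (hBP : B ⊆ P) (hiso : ∀ u : Fin n, u ≠ o → u ∉ P → W s(o, u) = 0) :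
    (prodBernoulli W).real (starEvent o (↑B : Set (Fin n))) =
      (∏ p ∈ B, (W s(o, p) : ℝ)) * ∏ u ∈ P \ B, (1 - (W s(o, u) : ℝ)) := by
  rw [real_starEvent_eq_prod W o B (fun h => hoP (hBP h))]
  congr 1
  symm
  apply Finset.prod_subset
  · intro u hu
    rw [Finset.mem_sdiff] at hu
    exact Finset.mem_filter.2 ⟨Finset.mem_univ _, fun h => hoP (h ▸ hu.1), hu.2⟩
  · intro u hu hnot
    rw [Finset.mem_filter] at hu
    have huP : u ∉ P := fun h => hnot (Finset.mem_sdiff.2 ⟨h, hu.2.2⟩)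
    rw [hiso u hu.2.1 huP]
    simp

/-- **The `2+2` kernel** (Kozma–Nitzan, Question 9 / inequality (41), for a depth-two observer made of two 2-port children and any core):
if the witness `j` satisfies the four SPLIT ROWS (see the module docstring; `u`, `v` are the products of the two pairs of hairs and `K`
is `W` with the observer `o` killed), then `μ_W(j ↔ b, o ↔ A) ≤ μ_W(o ↔ b)`.
[cite: KozmaNitzan2024, Question 9 (p. 36), Thm. 4–5 and Lemma 5 (pp. 12–14), Lemma 3(i) (p. 6); VandenbergHaggstromKahn2005, Thm. 1.2] -/
theorem kernel_twoPlusTwo (W : Sym2 (Fin n) → unitInterval) (A : Finset (Fin n)) (o p₁ p₂ q₁ q₂ j b : Fin n)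
    (K : Sym2 (Fin n) → unitInterval) (hK : K = fun e => if o ∈ e then 0 else W e)
    (u v : unitInterval) (hu : (u : ℝ) = (W s(o, p₁) : ℝ) * W s(o, p₂)) (hv : (v : ℝ) = (W s(o, q₁) : ℝ) * W s(o, q₂))
    (hoA : o ∉ A) (hp₁A : p₁ ∈ A) (hp₂A : p₂ ∈ A) (hq₁A : q₁ ∈ A) (hq₂A : q₂ ∈ A)
    (hp : p₁ ≠ p₂) (hq : q₁ ≠ q₂) (h11 : p₁ ≠ q₁) (h12 : p₁ ≠ q₂) (h21 : p₂ ≠ q₁) (h22 : p₂ ≠ q₂)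
    (hjo : j ≠ o) (hbo : b ≠ o)
    (hiso : ∀ u' : Fin n, u' ≠ o → u' ∉ ({p₁, p₂, q₁, q₂} : Finset (Fin n)) → W s(o, u') = 0) (hloop : W s(o, o) = 0)
    (hh₁ : 0 < (W s(o, p₁) : ℝ)) (hh₁' : (W s(o, p₁) : ℝ) < 1) (hh₂ : 0 < (W s(o, p₂) : ℝ)) (hh₂' : (W s(o, p₂) : ℝ) < 1)
    (hk₁ : 0 < (W s(o, q₁) : ℝ)) (hk₁' : (W s(o, q₁) : ℝ) < 1) (hk₂ : 0 < (W s(o, q₂) : ℝ)) (hk₂' : (W s(o, q₂) : ℝ) < 1)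
    (hrow : ∀ z ∈ ({p₁, p₂, q₁, q₂} : Finset (Fin n)), 0 ≤
      (1 - (u : ℝ)) * (1 - (v : ℝ)) * ((prodBernoulli K).real (openConn z b) - (prodBernoulli K).real (openConn j b)) +
      (u : ℝ) * (1 - (v : ℝ)) * ((prodBernoulli (fun f : Sym2 (Fin n) => if f = s(p₁, p₂) then 1 else K f)).real (openConn z b) -
        (prodBernoulli (fun f : Sym2 (Fin n) => if f = s(p₁, p₂) then 1 else K f)).real (openConn j b)) +
      (1 - (u : ℝ)) * (v : ℝ) * ((prodBernoulli (fun f : Sym2 (Fin n) => if f = s(q₁, q₂) then 1 else K f)).real (openConn z b) -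
        (prodBernoulli (fun f : Sym2 (Fin n) => if f = s(q₁, q₂) then 1 else K f)).real (openConn j b)) +
      (u : ℝ) * (v : ℝ) * ((prodBernoulli (fun f : Sym2 (Fin n) => if f = s(p₁, p₂) then 1 else if f = s(q₁, q₂) then 1 else K f)).real (openConn z b) -
        (prodBernoulli (fun f : Sym2 (Fin n) => if f = s(p₁, p₂) then 1 else if f = s(q₁, q₂) then 1 else K f)).real (openConn j b))) :
    (prodBernoulli W).real (openConn j b ∩ ⋃ a ∈ A, openConn o a) ≤ (prodBernoulli W).real (openConn o b) := by
  -- (0) bookkeeping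
  have hop₁ : o ≠ p₁ := fun h => hoA (h ▸ hp₁A)
  have hop₂ : o ≠ p₂ := fun h => hoA (h ▸ hp₂A)
  have hoq₁ : o ≠ q₁ := fun h => hoA (h ▸ hq₁A)
  have hoq₂ : o ≠ q₂ := fun h => hoA (h ▸ hq₂A)
  have hPPA : ({p₁, p₂, q₁, q₂} : Finset (Fin n)) ⊆ A := by
    intro z hz
    simp only [Finset.mem_insert, Finset.mem_singleton] at hz
    rcases hz with rfl | rfl | rfl | rfl <;> assumption
  have hp₁Q : p₁ ∉ ({q₁, q₂} : Finset (Fin n)) := by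
    simp only [Finset.mem_insert, Finset.mem_singleton, not_or]; exact ⟨h11, h12⟩
  have hp₂Q : p₂ ∉ ({q₁, q₂} : Finset (Fin n)) := by
    simp only [Finset.mem_insert, Finset.mem_singleton, not_or]; exact ⟨h21, h22⟩
  have hoQ : o ∉ ({q₁, q₂} : Finset (Fin n)) := by
    simp only [Finset.mem_insert, Finset.mem_singleton, not_or]; exact ⟨hoq₁, hoq₂⟩
  have hp₁n : p₁ ∉ ({p₂, q₁, q₂} : Finset (Fin n)) := by
    simp only [Finset.mem_insert, Finset.mem_singleton, not_or]; exact ⟨hp, h11, h12⟩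
  have hoPP : o ∉ ({p₁, p₂, q₁, q₂} : Finset (Fin n)) := by
    simp only [Finset.mem_insert, Finset.mem_singleton, not_or]; exact ⟨hop₁, hop₂, hoq₁, hoq₂⟩
  have hq₁₂ : q₁ ∉ ({q₂} : Finset (Fin n)) := by rw [Finset.mem_singleton]; exact hq
  have hisoK : ∀ u' : Fin n, u' ≠ o → K s(o, u') = 0 := fun u' _ => by rw [hK]; simp
  obtain ⟨G, hG⟩ : ∃ G : Finset (Fin n) → ℝ, ∀ T : Finset (Fin n), G T =
      (prodBernoulli (fun f : Sym2 (Fin n) => if f ∈ T.image (fun t => s(o, t)) then 1 else K f)).real (openConn o b) -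
        (prodBernoulli (fun f : Sym2 (Fin n) => if f ∈ T.image (fun t => s(o, t)) then 1 else K f)).real (openConn j b) :=
    ⟨_, fun T => rfl⟩
  obtain ⟨G', hG'⟩ : ∃ G' : Finset (Fin n) → ℝ, ∀ T : Finset (Fin n), G' T = if T = ∅ then 0 else G T := ⟨_, fun T => rfl⟩
  obtain ⟨ν, hν⟩ : ∃ ν : Finset (Fin n) → ℝ, ∀ Y : Finset (Fin n), ν Y =
      (∏ q ∈ Y, (W s(o, q) : ℝ)) * ∏ q ∈ ({q₁, q₂} : Finset (Fin n)) \ Y, (1 - (W s(o, q) : ℝ)) := ⟨_, fun Y => rfl⟩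
  have hνnn : ∀ S ∈ ({q₁, q₂} : Finset (Fin n)).powerset, 0 ≤ ν S := fun S _ => by
    rw [hν]
    exact mul_nonneg (Finset.prod_nonneg fun q _ => unitInterval.nonneg _)
      (Finset.prod_nonneg fun q _ => sub_nonneg.2 (unitInterval.le_one _))
  have hν0 : ν ∅ = (1 - (W s(o, q₁) : ℝ)) * (1 - (W s(o, q₂) : ℝ)) := by
    rw [hν, Finset.prod_empty, one_mul, Finset.sdiff_empty, Finset.prod_pair hq]
  have hν1 : ν {q₁} = (W s(o, q₁) : ℝ) * (1 - (W s(o, q₂) : ℝ)) := by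
    rw [hν, Finset.prod_singleton, Finset.insert_sdiff_of_mem _ (Finset.mem_singleton_self q₁),
      Finset.sdiff_singleton_eq_erase, Finset.erase_eq_of_notMem hq₁₂, Finset.prod_singleton]
  have hν2 : ν {q₂} = (W s(o, q₂) : ℝ) * (1 - (W s(o, q₁) : ℝ)) := by
    rw [hν, Finset.prod_singleton, Finset.insert_sdiff_of_notMem _ hq₁₂, Finset.sdiff_self, Finset.insert_empty,
      Finset.prod_singleton]
  have hν12 : ν {q₁, q₂} = (W s(o, q₁) : ℝ) * W s(o, q₂) := by
    rw [hν, Finset.prod_pair hq, Finset.sdiff_self, Finset.prod_empty, mul_one]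
  -- glue-condition facts for the empty set, singletons and the pair `{q₁, q₂}`
  have hcE : ∀ f : Sym2 (Fin n), ¬ ((∀ x ∈ f, x ∈ (∅ : Finset (Fin n))) ∧ ¬ f.IsDiag) := by
    rintro f ⟨h1, -⟩
    induction f using Sym2.ind with
    | h x y => exact Finset.notMem_empty x (h1 x (Sym2.mem_mk_left x y))
  have hcS : ∀ (z : Fin n) (f : Sym2 (Fin n)), ¬ ((∀ x ∈ f, x ∈ ({z} : Finset (Fin n))) ∧ ¬ f.IsDiag) := by
    rintro z f ⟨hall, hdiag⟩
    apply hdiag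
    induction f using Sym2.ind with
    | h x y =>
      rw [Finset.mem_singleton.1 (hall x (Sym2.mem_mk_left x y)), Finset.mem_singleton.1 (hall y (Sym2.mem_mk_right x y))]
      exact Sym2.mk_isDiag_iff.2 rfl
  have hcP : ∀ f : Sym2 (Fin n), ((∀ x ∈ f, x ∈ ({q₁, q₂} : Finset (Fin n))) ∧ ¬ f.IsDiag) ↔ f = s(q₁, q₂) := by
    intro f
    constructor
    · rintro ⟨hall, hdiag⟩
      induction f using Sym2.ind with
      | h x y =>
        have hx := hall x (Sym2.mem_mk_left x y)
        have hy := hall y (Sym2.mem_mk_right x y)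
        simp only [Finset.mem_insert, Finset.mem_singleton] at hx hy
        rw [Sym2.mk_isDiag_iff] at hdiag
        rcases hx with rfl | rfl <;> rcases hy with rfl | rfl
        · exact absurd rfl hdiag
        · rfl
        · exact Sym2.eq_swap
        · exact absurd rfl hdiag
    · rintro rfl
      refine ⟨fun x hx => ?_, fun h => hq (Sym2.mk_isDiag_iff.1 h)⟩
      rcases Sym2.mem_iff.1 hx with rfl | rfl <;> simp
  have hGE : (fun e : Sym2 (Fin n) => if (∀ x ∈ e, x ∈ (∅ : Finset (Fin n))) ∧ ¬ e.IsDiag then (1 : unitInterval) else K e) = K :=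
    funext fun e => if_neg (hcE e)
  have hGS : ∀ z : Fin n,
      (fun e : Sym2 (Fin n) => if (∀ x ∈ e, x ∈ ({z} : Finset (Fin n))) ∧ ¬ e.IsDiag then (1 : unitInterval) else K e) = K :=
    fun z => funext fun e => if_neg (hcS z e)
  -- (1) the σ-law expansion in forced-star coordinates
  have hexp := oneLayer_margin_eq_sum_forced W A {p₁, p₂, q₁, q₂} o j b hoA hPPA hbo hiso hloop
  have hforced : ∀ T : Finset (Fin n),
      (fun e : Sym2 (Fin n) => if o ∈ e then (if ∃ p ∈ T, e = s(o, p) then (1 : unitInterval) else 0) else W e) =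
        fun f => if f ∈ T.image (fun t => s(o, t)) then 1 else K f := by
    intro T; rw [forcedStar_eq_memForm W o T, hK]
  have hterm : ∀ B ∈ ({p₁, p₂, q₁, q₂} : Finset (Fin n)).powerset,
      (if B = ∅ then (0 : ℝ) else
        (prodBernoulli W).real (starEvent o (↑B : Set (Fin n))) *
          ((prodBernoulli (fun e : Sym2 (Fin n) => if o ∈ e then (if ∃ p ∈ B, e = s(o, p) then 1 else 0) else W e)).real
              (openConn o b) -
            (prodBernoulli (fun e : Sym2 (Fin n) => if o ∈ e then (if ∃ p ∈ B, e = s(o, p) then 1 else 0) else W e)).real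
              (openConn j b))) =
      (if B = ∅ then (0 : ℝ) else
        ((∏ p ∈ B, (W s(o, p) : ℝ)) * ∏ u' ∈ ({p₁, p₂, q₁, q₂} : Finset (Fin n)) \ B, (1 - (W s(o, u') : ℝ))) * G B) := by
    intro B hB
    by_cases hBe : B = ∅
    · rw [if_pos hBe, if_pos hBe]
    · rw [if_neg hBe, if_neg hBe,
        real_starEvent_eq_prod_ports W o {p₁, p₂, q₁, q₂} B hoPP (Finset.mem_powerset.1 hB) hiso, hforced B, hG B]
  have hexp' := hexp.trans (Finset.sum_congr rfl hterm)
  -- (2) expansion over the `x`-ports `p₁, p₂`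
  have hS : ∑ B ∈ ({p₁, p₂, q₁, q₂} : Finset (Fin n)).powerset, (if B = ∅ then (0 : ℝ) else
        ((∏ p ∈ B, (W s(o, p) : ℝ)) * ∏ u' ∈ ({p₁, p₂, q₁, q₂} : Finset (Fin n)) \ B, (1 - (W s(o, u') : ℝ))) * G B) =
      ∑ Y ∈ ({q₁, q₂} : Finset (Fin n)).powerset, ν Y *
        ((1 - (W s(o, p₁) : ℝ)) * (1 - (W s(o, p₂) : ℝ)) * G' Y + (1 - (W s(o, p₁) : ℝ)) * W s(o, p₂) * G (insert p₂ Y) +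
          (W s(o, p₁) : ℝ) * (1 - (W s(o, p₂) : ℝ)) * G (insert p₁ Y) +
          (W s(o, p₁) : ℝ) * W s(o, p₂) * G (insert p₁ (insert p₂ Y))) := by
    rw [Finset.sum_powerset_insert hp₁n, Finset.sum_powerset_insert hp₂Q, Finset.sum_powerset_insert hp₂Q,
      ← Finset.sum_add_distrib, ← Finset.sum_add_distrib, ← Finset.sum_add_distrib]
    refine Finset.sum_congr rfl fun Y hY => ?_
    have hYQ : Y ⊆ {q₁, q₂} := Finset.mem_powerset.1 hY
    have hp₁Y : p₁ ∉ Y := fun h => hp₁Q (hYQ h)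
    have hp₂Y : p₂ ∉ Y := fun h => hp₂Q (hYQ h)
    have hp₁Y₂ : p₁ ∉ insert p₂ Y := by rw [Finset.mem_insert, not_or]; exact ⟨hp, hp₁Y⟩
    have hp₂Y₁ : p₂ ∉ insert p₁ Y := by rw [Finset.mem_insert, not_or]; exact ⟨hp.symm, hp₂Y⟩
    have hp₁QY : p₁ ∉ ({q₁, q₂} : Finset (Fin n)) \ Y := fun h => hp₁Q (Finset.mem_sdiff.1 h).1
    have hp₂QY : p₂ ∉ ({q₁, q₂} : Finset (Fin n)) \ Y := fun h => hp₂Q (Finset.mem_sdiff.1 h).1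
    have hp₁QY₂ : p₁ ∉ insert p₂ (({q₁, q₂} : Finset (Fin n)) \ Y) := by
      rw [Finset.mem_insert, not_or]; exact ⟨hp, hp₁QY⟩
    have ea : ({p₁, p₂, q₁, q₂} : Finset (Fin n)) \ Y = insert p₁ (insert p₂ (({q₁, q₂} : Finset (Fin n)) \ Y)) := by
      rw [Finset.insert_sdiff_of_notMem _ hp₁Y, Finset.insert_sdiff_of_notMem _ hp₂Y]
    have eb : ({p₁, p₂, q₁, q₂} : Finset (Fin n)) \ insert p₂ Y = insert p₁ (({q₁, q₂} : Finset (Fin n)) \ Y) := by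
      rw [Finset.insert_sdiff_of_notMem _ hp₁Y₂, Finset.insert_sdiff_insert, Finset.sdiff_insert_of_notMem hp₂Q]
    have ec : ({p₁, p₂, q₁, q₂} : Finset (Fin n)) \ insert p₁ Y = insert p₂ (({q₁, q₂} : Finset (Fin n)) \ Y) := by
      rw [Finset.insert_sdiff_insert, Finset.insert_sdiff_of_notMem _ hp₂Y₁, Finset.sdiff_insert_of_notMem hp₁Q]
    have ed : ({p₁, p₂, q₁, q₂} : Finset (Fin n)) \ insert p₁ (insert p₂ Y) = ({q₁, q₂} : Finset (Fin n)) \ Y := by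
      rw [Finset.insert_sdiff_insert,
        Finset.insert_sdiff_of_mem _ (Finset.mem_insert_of_mem (Finset.mem_insert_self p₂ Y)),
        Finset.sdiff_insert_of_notMem hp₁Q, Finset.sdiff_insert_of_notMem hp₂Q]
    rw [if_neg (Finset.insert_ne_empty p₂ Y), if_neg (Finset.insert_ne_empty p₁ Y),
      if_neg (Finset.insert_ne_empty p₁ (insert p₂ Y)), ea, eb, ec, ed,
      Finset.prod_insert hp₁Y₂, Finset.prod_insert hp₂Y, Finset.prod_insert hp₁Y,
      Finset.prod_insert hp₁QY₂, Finset.prod_insert hp₂QY, Finset.prod_insert hp₁QY, hν Y, hG' Y]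
    by_cases hYe : Y = ∅
    · rw [if_pos hYe, if_pos hYe]; ring
    · rw [if_neg hYe, if_neg hYe]; ring
  -- (3) the margin as an affine function of the two `x`-hairs (`u = h₁ h₂` fixed)
  obtain ⟨c, hc⟩ : ∃ c : ℝ, c = ∑ Y ∈ ({q₁, q₂} : Finset (Fin n)).powerset,
      ν Y * ((1 - (u : ℝ)) * G' Y + (u : ℝ) * G (insert p₁ (insert p₂ Y))) := ⟨_, rfl⟩
  obtain ⟨d₁, hd₁⟩ : ∃ d₁ : ℝ, d₁ = ∑ Y ∈ ({q₁, q₂} : Finset (Fin n)).powerset, ν Y * (G (insert p₁ Y) - G' Y) :=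
    ⟨_, rfl⟩
  obtain ⟨d₂, hd₂⟩ : ∃ d₂ : ℝ, d₂ = ∑ Y ∈ ({q₁, q₂} : Finset (Fin n)).powerset, ν Y * (G (insert p₂ Y) - G' Y) :=
    ⟨_, rfl⟩
  have hF : ∑ Y ∈ ({q₁, q₂} : Finset (Fin n)).powerset, ν Y *
        ((1 - (W s(o, p₁) : ℝ)) * (1 - (W s(o, p₂) : ℝ)) * G' Y + (1 - (W s(o, p₁) : ℝ)) * W s(o, p₂) * G (insert p₂ Y) +
          (W s(o, p₁) : ℝ) * (1 - (W s(o, p₂) : ℝ)) * G (insert p₁ Y) +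
          (W s(o, p₁) : ℝ) * W s(o, p₂) * G (insert p₁ (insert p₂ Y))) =
      c + d₁ * ((W s(o, p₁) : ℝ) - u) + d₂ * ((W s(o, p₂) : ℝ) - u) := by
    rw [hc, hd₁, hd₂, Finset.sum_mul, Finset.sum_mul, ← Finset.sum_add_distrib, ← Finset.sum_add_distrib]
    refine Finset.sum_congr rfl fun Y _ => ?_
    rw [hu]; ring
  have min3 : ∀ {a₁ a₂ a₃ x : ℝ}, 0 ≤ a₁ → 0 ≤ a₂ → 0 ≤ a₃ → min a₁ (min a₂ a₃) ≤ x → 0 ≤ x :=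
    fun h1 h2 h3 h => (le_min h1 (le_min h2 h3)).trans h
  have hu0 : 0 ≤ (u : ℝ) := unitInterval.nonneg u
  have hu1 : (u : ℝ) < 1 := by rw [hu]; exact mul_lt_one_of_nonneg_of_lt_one_left hh₁.le hh₁' hh₂'.le
  have hv0 : 0 ≤ (v : ℝ) := unitInterval.nonneg v
  have hv1 : (v : ℝ) < 1 := by rw [hv]; exact mul_lt_one_of_nonneg_of_lt_one_left hk₁.le hk₁' hk₂'.le
  -- (4a) the two sure-hair (ARC) corners in `x`
  have hA₁ : 0 ≤ ∑ S ∈ ({q₁, q₂} : Finset (Fin n)).powerset,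
      ν S * ((1 - (u : ℝ)) * G (insert p₁ S) + (u : ℝ) * G (insert p₂ (insert p₁ S))) := by
    refine arcCorner K o p₁ p₂ j b {q₁, q₂} ν hνnn u hoQ hp₁Q hp₂Q hp hop₁ hop₂ hjo hbo hisoK G hG ?_
    rw [ML5Base.sum_powerset_pair hq, hν0, hν1, hν2, hν12, hGE, hGS q₁, hGS q₂, glue_pair_eq K hq]
    simp only [hcE, hcS, hcP, if_false]
    have hr := hrow p₁ (by simp)
    rw [hv] at hr
    linarith
  have hA₂ : 0 ≤ ∑ S ∈ ({q₁, q₂} : Finset (Fin n)).powerset,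
      ν S * ((1 - (u : ℝ)) * G (insert p₂ S) + (u : ℝ) * G (insert p₁ (insert p₂ S))) := by
    refine arcCorner K o p₂ p₁ j b {q₁, q₂} ν hνnn u hoQ hp₂Q hp₁Q hp.symm hop₂ hop₁ hjo hbo hisoK G hG ?_
    rw [ML5Base.sum_powerset_pair hq, hν0, hν1, hν2, hν12, hGE, hGS q₁, hGS q₂, glue_pair_eq K hq]
    simp only [hcE, hcS, hcP, if_false]
    have hr := hrow p₂ (by simp)
    rw [hv, show s(p₁, p₂) = s(p₂, p₁) from Sym2.eq_swap] at hr
    linarith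
  have hc1 : 0 ≤ c + d₁ * (1 - (u : ℝ)) := by
    have e : c + d₁ * (1 - (u : ℝ)) = ∑ S ∈ ({q₁, q₂} : Finset (Fin n)).powerset,
        ν S * ((1 - (u : ℝ)) * G (insert p₁ S) + (u : ℝ) * G (insert p₂ (insert p₁ S))) := by
      rw [hc, hd₁, Finset.sum_mul, ← Finset.sum_add_distrib]
      refine Finset.sum_congr rfl fun Y _ => ?_
      rw [Finset.insert_comm p₁ p₂ Y]; ring
    rw [e]; exact hA₁
  have hc2 : 0 ≤ c + d₂ * (1 - (u : ℝ)) := by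
    have e : c + d₂ * (1 - (u : ℝ)) = ∑ S ∈ ({q₁, q₂} : Finset (Fin n)).powerset,
        ν S * ((1 - (u : ℝ)) * G (insert p₂ S) + (u : ℝ) * G (insert p₁ (insert p₂ S))) := by
      rw [hc, hd₂, Finset.sum_mul, ← Finset.sum_add_distrib]
      refine Finset.sum_congr rfl fun Y _ => ?_
      ring
    rw [e]; exact hA₂
  -- (4b) the formal corner in `x`: the same reduction in `y`, with the FF and MIXED corners
  have s1 : ({q₂, q₁} : Finset (Fin n)) = {q₁, q₂} := Finset.pair_comm q₂ q₁
  have s2 : ({q₁, p₁, p₂} : Finset (Fin n)) = {p₁, p₂, q₁} := by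
    rw [Finset.insert_comm q₁ p₁, Finset.pair_comm q₁ p₂]
  have s3 : ({q₂, p₁, p₂} : Finset (Fin n)) = {p₁, p₂, q₂} := by
    rw [Finset.insert_comm q₂ p₁, Finset.pair_comm q₂ p₂]
  have s4 : ({q₂, q₁, p₁, p₂} : Finset (Fin n)) = {p₁, p₂, q₁, q₂} := by
    rw [Finset.insert_comm q₁ p₁, Finset.pair_comm q₁ p₂, Finset.insert_comm q₂ p₁, Finset.insert_comm q₂ p₂,
      Finset.pair_comm q₂ q₁]
  have s5 : ({q₁, q₂, p₁, p₂} : Finset (Fin n)) = {p₁, p₂, q₁, q₂} := by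
    rw [Finset.insert_comm q₂ p₁, Finset.pair_comm q₂ p₂, Finset.insert_comm q₁ p₁, Finset.insert_comm q₁ p₂]
  have hff := ffCorner K o p₁ p₂ q₁ q₂ j b u v hp hq h11 h12 h21 h22 hop₁ hop₂ hoq₁ hoq₂ hjo hbo hisoK G hG hrow
  have hm₁ := mixedCorner K o p₁ p₂ q₁ q₂ j b u v hp hq h11 h12 h21 h22 hop₁ hop₂ hoq₁ hoq₂ hjo hbo hisoK G hG
    (hrow q₁ (by simp))
  have hm₂ := mixedCorner K o p₁ p₂ q₂ q₁ j b u v hp hq.symm h12 h11 h22 h21 hop₁ hop₂ hoq₂ hoq₁ hjo hbo hisoK G hG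
    (by
      have hr := hrow q₂ (by simp)
      rw [show s(q₁, q₂) = s(q₂, q₁) from Sym2.eq_swap] at hr
      exact hr)
  rw [s4] at hff
  rw [s4, s1, s2] at hm₁
  rw [s5, s3] at hm₂
  have hc0 : 0 ≤ c := by
    have hminy := hyperbola_affine_ge_min3
      (c := (u : ℝ) * (1 - (v : ℝ)) * G {p₁, p₂} + (1 - (u : ℝ)) * (v : ℝ) * G {q₁, q₂} +
        (u : ℝ) * (v : ℝ) * G {p₁, p₂, q₁, q₂})
      (d₁ := (1 - (u : ℝ)) * G {q₁} + (u : ℝ) * G {p₁, p₂, q₁} - (u : ℝ) * G {p₁, p₂})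
      (d₂ := (1 - (u : ℝ)) * G {q₂} + (u : ℝ) * G {p₁, p₂, q₂} - (u : ℝ) * G {p₁, p₂})
      hv0 hv1 hk₁ hk₂ hk₁'.le hk₂'.le hv.symm
    have key := min3 (by linarith) (by linarith) (by linarith) hminy
    rw [hc, ML5Base.sum_powerset_pair hq, hν0, hν1, hν2, hν12, hG', hG', hG', hG', if_pos (rfl : (∅ : Finset (Fin n)) = ∅),
      if_neg (Finset.singleton_ne_empty q₁), if_neg (Finset.singleton_ne_empty q₂),
      if_neg (Finset.insert_ne_empty q₁ {q₂}), Finset.insert_empty]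
    rw [hv] at key
    linarith
  -- (5) conclusion: the convexity step in `x`
  have hminx := hyperbola_affine_ge_min3 (c := c) (d₁ := d₁) (d₂ := d₂) hu0 hu1 hh₁ hh₂ hh₁'.le hh₂'.le hu.symm
  have hfin := min3 hc0 hc1 hc2 hminx
  have htot : 0 ≤ (prodBernoulli W).real (openConn o b) -
      (prodBernoulli W).real (openConn j b ∩ ⋃ a ∈ A, openConn o a) := by
    rw [hexp', hS, hF]; exact hfin
  exact sub_nonneg.1 htot

end UpsetExchange

end

end Summit.CriticalPhenomena.PercolationContinuityZ3.Theorems
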